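import Literature.NumberTheory.DiophantineGeometry.CatalanThaineMain
import Literature.NumberTheory.Automorphic.GaloisActionPlaces
import Mathlib.RingTheory.Frobenius
import Mathlib.RingTheory.DedekindDomain.AdicValuation
import HarnessLib

/-!
# Thaine's theorem for `ℚ(ζ_p)`, VI: the auxiliary prime from a Frobenius [Schoof2009, Lemma 16.2]

[Schoof2009, Lemma 16.2] produces the auxiliary prime `𝔩` of Thaine's theorem by Chebotarëv's
density theorem applied to a prescribed element `g` of the Galois group of
`Ω = K(ζ_q, ᵠ√E, H)` ([Schoof2009, pp. 112–113]). This file is the dictionary between the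
Frobenius condition and the hypothesis `hAux` of `Catalan.Thaine.thaine` (part V): **if `g` fixes
`ζ_q`, multiplies the `q`-th root `α_a` of `σ_a(u₀)` by `ζ_q^{[a = ±1]}`, and is the arithmetic
Frobenius at a prime `Q` of `Ω` above a degree-one prime `v ∤ pq` of `K`, then `𝔩 = v` is an
auxiliary prime for `u₀`**: `l = N(v) ≡ 1 (mod p)` and `(mod q)`, `u₀` is not a `q`-th power
modulo `𝔩` but is one modulo `σ_b(𝔩)`, `b ≠ ±1` (Euler's criterion in `𝓞 K/𝔩 ≅ 𝔽_l`:
`g(α_a) ≡ α_a^{l} (mod Q)` gives `σ_a(u₀)^{(l-1)/q} ≡ ζ_q^{[a=±1]} (mod Q)`).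

* `Catalan.Thaine.exists_pow_eq_of_pow_div_eq_one` — Euler's criterion in `𝓞 K/𝔩`;
* `Catalan.Thaine.auxPrime_of_isArithFrobAt` — the dictionary above (the class condition
  `QRel q 𝔩 𝔠` is threaded through as a hypothesis, to be supplied by class field theory).

Everything is proved; no definitions.

## References

* R. Schoof, *Catalan's Conjecture*, Universitext, Springer 2009 [Schoof2009], Lemma 16.2 and
  its proof (book pp. 109, 112–113) — held, `lit read book:schoof2009-catalan-s-conjecture`
  (PDF pp. 183, 186–188).
* L. C. Washington, *Introduction to Cyclotomic Fields*, GTM 83, Springer 1997 [Washington1997],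
  §15.2.
-/

namespace Literature.NumberTheory.DiophantineGeometry

namespace Catalan.Thaine

open _root_.NumberField Finset Ideal IsCyclotomicExtension IsDedekindDomain
open Literature.NumberTheory.NumberFields.Stickelberger
open scoped Pointwise

variable {p : ℕ} [hp : Fact p.Prime] {K : Type} [Field K] [NumberField K]
  [hK : IsCyclotomicExtension {p} ℚ K]

/-! ### Euler's criterion in `𝓞 K / 𝔩 ≅ 𝔽_l` -/

omit hp hK [NumberField K] in
/-- **Euler's criterion**: in a finite field quotient `𝓞 K/𝔩` with `l = #(𝓞 K/𝔩)` elements and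
`q ∣ l - 1`, an element `x ∉ 𝔩` with `x^{(l-1)/q} ≡ 1 (mod 𝔩)` is a `q`-th power modulo `𝔩`.
[folklore] -/
theorem exists_pow_eq_of_pow_div_eq_one {𝔩 : Ideal (𝓞 K)} [𝔩.IsMaximal] {l q : ℕ}
    (hcard : Nat.card (𝓞 K ⧸ 𝔩) = l) (hl : 1 < l) (hq : 0 < q) (hlq : q ∣ l - 1) {x : 𝓞 K}
    (hx : x ∉ 𝔩) (h1 : x ^ ((l - 1) / q) - 1 ∈ 𝔩) : ∃ z : 𝓞 K, z ∉ 𝔩 ∧ x - z ^ q ∈ 𝔩 := by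
  classical
  haveI : Finite (𝓞 K ⧸ 𝔩) := Nat.finite_of_card_ne_zero (by rw [hcard]; omega)
  letI : Fintype (𝓞 K ⧸ 𝔩) := Fintype.ofFinite _
  letI : Field (𝓞 K ⧸ 𝔩) := Ideal.Quotient.field _
  have hcardU : Fintype.card (𝓞 K ⧸ 𝔩)ˣ = l - 1 := by
    rw [Fintype.card_units, Fintype.card_eq_nat_card, hcard]
  obtain ⟨g, hg⟩ := IsCyclic.exists_generator (α := (𝓞 K ⧸ 𝔩)ˣ)
  have hordg : orderOf g = l - 1 := by
    rw [orderOf_eq_card_of_forall_mem_zpowers hg, Nat.card_eq_fintype_card, hcardU]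
  have hx0 : Ideal.Quotient.mk 𝔩 x ≠ 0 := by rwa [Ne, Ideal.Quotient.eq_zero_iff_mem]
  obtain ⟨m, hm⟩ := Subgroup.mem_zpowers_iff.mp (hg (Units.mk0 _ hx0))
  obtain ⟨d, hd⟩ := hlq
  -- `g^{m (l-1)/q} = 1`, so `l - 1 ∣ m d`, so `q ∣ m`
  have h2 : (Units.mk0 _ hx0 : (𝓞 K ⧸ 𝔩)ˣ) ^ ((l - 1) / q) = 1 := by
    apply Units.ext
    rw [Units.val_pow_eq_pow_val, Units.val_mk0, ← map_pow, Units.val_one, ← (Ideal.Quotient.mk 𝔩).map_one,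
      Ideal.Quotient.eq]
    exact h1
  have hdq : (l - 1) / q = d := by rw [hd, Nat.mul_div_cancel_left _ hq]
  rw [← hm, ← zpow_natCast, ← zpow_mul, ← orderOf_dvd_iff_zpow_eq_one, hordg, hdq] at h2
  -- `q d ∣ m d` gives `q ∣ m`
  have hd0 : d ≠ 0 := by rintro rfl; rw [mul_zero] at hd; omega
  have hqm : (q : ℤ) ∣ m := by
    rw [hd] at h2
    push_cast at h2
    exact (mul_dvd_mul_iff_right (show (d : ℤ) ≠ 0 by exact_mod_cast hd0)).mp h2
  obtain ⟨e, he⟩ := hqm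
  obtain ⟨z, hz⟩ := Ideal.Quotient.mk_surjective (((g ^ e : (𝓞 K ⧸ 𝔩)ˣ) : 𝓞 K ⧸ 𝔩))
  refine ⟨z, fun hz0 => ?_, ?_⟩
  · rw [← Ideal.Quotient.eq_zero_iff_mem, hz] at hz0
    exact Units.ne_zero _ hz0
  · have h3 : (Units.mk0 _ hx0 : (𝓞 K ⧸ 𝔩)ˣ) = (g ^ e) ^ q := by
      rw [← hm, ← zpow_natCast, ← zpow_mul, mul_comm, ← he]
    rw [← Ideal.Quotient.eq, map_pow, hz, ← Units.val_pow_eq_pow_val, ← h3, Units.val_mk0]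

/-! ### Roots of unity modulo `Q` -/

/-- If `ζ` is a primitive `m`-th root of unity (`m > 1`) and `ζ ≡ 1 (mod Q)`, then `m ∈ Q`
(`0 = 1 + ζ + ⋯ + ζ^{m-1} ≡ m`). [folklore] -/
theorem natCast_mem_of_sub_one_mem {S : Type*} [CommRing S] [IsDomain S] {ζ : S} {m : ℕ}
    (hζ : IsPrimitiveRoot ζ m) (hm : 1 < m) {Q : Ideal S} (h : ζ - 1 ∈ Q) : (m : S) ∈ Q := by
  have h0 := hζ.geom_sum_eq_zero hm
  have e : (m : S) = - ∑ i ∈ Finset.range m, (ζ ^ i - 1) := by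
    rw [Finset.sum_sub_distrib, h0, Finset.sum_const, Finset.card_range]; simp
  rw [e]
  refine neg_mem_iff.mpr (Ideal.sum_mem _ fun i _ => ?_)
  obtain ⟨c, hc⟩ := sub_dvd_pow_sub_pow ζ 1 i
  rw [one_pow] at hc
  rw [hc]
  exact Ideal.mul_mem_right _ _ h

/-! ### The auxiliary prime from a Frobenius -/

variable {Ω : Type} [Field Ω] [NumberField Ω] [Algebra K Ω]

include hK in
/-- **The auxiliary prime of [Schoof2009, Lemma 16.2] from a Frobenius element.** Let
`K = ℚ(ζ_p)`, `q` an odd prime, `u₀ = ε π^{m}` a `p`-unit of `K`, `Ω/K` finite Galois containing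
a primitive `q`-th root of unity `ζ_q` and `q`-th roots `α_a` of `σ_a(u₀)` (`a ∈ G`), and let
`g ∈ Gal(Ω/K)` fix `ζ_q` and act by `g(α_a) = ζ_q^{[a = ±1]} α_a`. If `g` is the arithmetic
Frobenius at a prime `Q` of `Ω` above a prime `𝔩 ∤ pq` of `K` of prime norm `l` (as provided by
Chebotarëv's theorem), then `l ≡ 1 (mod p)`, `l ≡ 1 (mod q)`, `u₀` is not a `q`-th power modulo
`𝔩`, and `u₀` is a `q`-th power modulo `σ_b(𝔩)` for every `b ≠ ±1` — together with the class
condition `QRel q 𝔩 𝔠` (threaded through), exactly the hypothesis `hAux` of `thaine`.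
(`g(x) ≡ x^l (mod Q)`: on `ζ_p, ζ_q` this gives `pq ∣ l - 1`; on `α_a` it gives Euler's criterion
`σ_a(u₀)^{(l-1)/q} ≡ ζ_q^{[a=±1]} (mod Q)`.)
[cite: Schoof2009, Lemma 16.2 (proof, pp. 112–113)] [cite: Washington1997, §15.2] -/
theorem auxPrime_of_isArithFrobAt {q : ℕ} (hqp : q.Prime) {ζ : K} (hζ : IsPrimitiveRoot ζ p)
    {u₀ : 𝓞 K} {εu : (𝓞 K)ˣ} {mu : ℕ} (hu : u₀ = εu * (hζ.toInteger - 1) ^ mu)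
    {𝔠 : Ideal (𝓞 K)} (𝔩 : Ideal (𝓞 K)) [h𝔩m : 𝔩.IsMaximal] (hl : (Ideal.absNorm 𝔩).Prime)
    (hp𝔩 : ((p : ℕ) : 𝓞 K) ∉ 𝔩) (hq𝔩 : ((q : ℕ) : 𝓞 K) ∉ 𝔩) (hrel : QRel q 𝔩 𝔠)
    {ζq : 𝓞 Ω} (hζq : IsPrimitiveRoot (ζq : Ω) q) {α : (ZMod p)ˣ → 𝓞 Ω}
    (hα : ∀ a, α a ^ q = algebraMap (𝓞 K) (𝓞 Ω) (gal p K a • u₀))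
    {g : Ω ≃ₐ[K] Ω} (hgζ : g • ζq = ζq)
    (hgα : ∀ a, g • α a = ζq ^ (if a = 1 ∨ a = -1 then 1 else 0) * α a)
    (Q : Ideal (𝓞 Ω)) [Q.IsPrime] [hQ : Q.LiesOver 𝔩] (hfrob : IsArithFrobAt (𝓞 K) g Q) :
    ∃ (l : ℕ) (_ : Fact l.Prime) (𝔩' : Ideal (𝓞 K)) (_ : 𝔩'.IsMaximal)
      (_ : 𝔩'.LiesOver (Ideal.span {(l : ℤ)})),
      p ≠ l ∧ p ∣ l - 1 ∧ q ∣ l - 1 ∧ QRel q 𝔩' 𝔠 ∧ (¬ ∃ z : 𝓞 K, u₀ - z ^ q ∈ 𝔩') ∧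
      (∀ b : (ZMod p)ˣ, b ≠ 1 → b ≠ -1 →
        ∃ z : 𝓞 K, z ∉ gal p K b • 𝔩' ∧ u₀ - z ^ q ∈ gal p K b • 𝔩') := by
  classical
  set l : ℕ := Ideal.absNorm 𝔩 with hldef
  haveI hlF : Fact l.Prime := ⟨hl⟩
  have hl1 : 1 < l := hl.one_lt
  -- `#(𝓞 K/𝔩) = l`, `𝔩 ∩ ℤ = (l)`
  have hcard : Nat.card (𝓞 K ⧸ 𝔩) = l := by
    rw [hldef, Ideal.absNorm_apply, Submodule.cardQuot_apply]
  have hlmem : ((l : ℕ) : 𝓞 K) ∈ 𝔩 := Ideal.absNorm_mem 𝔩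
  haveI h𝔩l : 𝔩.LiesOver (Ideal.span {(l : ℤ)}) := by
    have hprime : (Ideal.span {(l : ℤ)}).IsPrime :=
      (Ideal.span_singleton_prime (by exact_mod_cast hl.ne_zero)).mpr (Nat.prime_iff_prime_int.mp hl)
    have hmax : (Ideal.span {(l : ℤ)}).IsMaximal :=
      hprime.isMaximal (by rw [Ne, Ideal.span_singleton_eq_bot]; exact_mod_cast hl.ne_zero)
    have hle : Ideal.span {(l : ℤ)} ≤ 𝔩.under ℤ := by
      rw [Ideal.span_le, Set.singleton_subset_iff]
      show algebraMap ℤ (𝓞 K) l ∈ 𝔩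
      simpa using hlmem
    exact ⟨hmax.eq_of_le Ideal.IsPrime.ne_top' hle⟩
  have hpl : p ≠ l := by
    rintro rfl; exact hp𝔩 hlmem
  -- the Frobenius congruence `g x ≡ x^l (mod Q)`
  have hunder : Q.under (𝓞 K) = 𝔩 := hQ.over.symm
  have hN : Nat.card (𝓞 K ⧸ Q.under (𝓞 K)) = l := by rw [hunder, hcard]
  have hfrob' : ∀ x : 𝓞 Ω, g • x - x ^ l ∈ Q := fun x => by
    have := hfrob x; rwa [hN] at this
  have hmemQ : ∀ {x : 𝓞 K}, algebraMap (𝓞 K) (𝓞 Ω) x ∈ Q ↔ x ∈ 𝔩 := fun {x} => by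
    rw [← Ideal.mem_comap]
    show x ∈ Q.under (𝓞 K) ↔ _
    rw [hunder]
  have hpQ : ((p : ℕ) : 𝓞 Ω) ∉ Q := fun h => hp𝔩 (hmemQ.mp (by simpa using h))
  have hqQ : ((q : ℕ) : 𝓞 Ω) ∉ Q := fun h => hq𝔩 (hmemQ.mp (by simpa using h))
  have hgalg : ∀ x : 𝓞 Ω, (MulSemiringAction.toAlgHom (𝓞 K) (𝓞 Ω) g) x = g • x := fun x => rfl
  -- a root of unity of order `m` with `m ∉ Q`, fixed by `g`, forces `m ∣ l - 1`
  have hdvd : ∀ {x : 𝓞 Ω} {m : ℕ}, IsPrimitiveRoot (x : Ω) m → ((m : ℕ) : 𝓞 Ω) ∉ Q → g • x = x →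
      m ∣ l - 1 := by
    intro x m hx hm hgx
    have hx1 : x ^ m = 1 := by
      apply RingOfIntegers.coe_injective
      simp [hx.pow_eq_one]
    have h1 := hfrob.apply_of_pow_eq_one hx1 hm
    rw [hgalg, hgx, hN] at h1
    have hx0 : x ≠ 0 := by
      rintro rfl
      have := hx.ne_zero (by rintro rfl; simp at hm)
      exact this rfl
    have h2 : x ^ (l - 1) = 1 := by
      have e : x ^ (l - 1) * x = 1 * x := by
        rw [← pow_succ, Nat.sub_add_cancel hl1.le, one_mul]; exact h1.symm
      exact mul_right_cancel₀ hx0 e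
    have h3 : (x : Ω) ^ (l - 1) = 1 := by
      have := congrArg (fun y : 𝓞 Ω => (y : Ω)) h2
      simpa using this
    exact (hx.pow_eq_one_iff_dvd _).mp h3
  -- `p ∣ l - 1` (Frobenius on `ζ_p`) and `q ∣ l - 1` (on `ζ_q`)
  have hpl1 : p ∣ l - 1 := by
    refine hdvd (x := algebraMap (𝓞 K) (𝓞 Ω) hζ.toInteger) (m := p) ?_ hpQ (smul_algebraMap g _)
    have : ((algebraMap (𝓞 K) (𝓞 Ω) hζ.toInteger : 𝓞 Ω) : Ω) = algebraMap K Ω ζ := rfl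
    rw [this]
    exact hζ.map_of_injective (algebraMap K Ω).injective
  have hql1 : q ∣ l - 1 := hdvd hζq hqQ hgζ
  obtain ⟨d, hd⟩ := hql1
  -- `u₀` and its conjugates are prime to `𝔩`
  have hu0 : ∀ b, u₀ ∉ gal p K b • 𝔩 := fun b => by
    rw [hu]; exact punit_not_mem_smul (K := K) 𝔩 hpl hζ εu mu b
  have hσu0 : ∀ a, gal p K a • u₀ ∉ 𝔩 := fun a h => by
    have := (Ideal.smul_mem_pointwise_smul_iff (a := (gal p K a)⁻¹)).mpr h
    rw [inv_smul_smul] at this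
    exact hu0 _ (by rwa [← gal_inv] at this)
  -- Euler's criterion from the Frobenius: `σ_a(u₀)^d ≡ ζ_q^{k_a} (mod Q)`
  have heuler : ∀ a, ζq ^ (if a = 1 ∨ a = -1 then 1 else 0) -
      algebraMap (𝓞 K) (𝓞 Ω) ((gal p K a • u₀) ^ d) ∈ Q := by
    intro a
    have h1 := hfrob' (α a)
    rw [hgα a] at h1
    have hα0 : α a ∉ Q := fun h => by
      have : α a ^ q ∈ Q := Ideal.pow_mem_of_mem Q h q hqp.pos
      rw [hα a, hmemQ] at this
      exact hσu0 a this
    have e : ζq ^ (if a = 1 ∨ a = -1 then 1 else 0) * α a - α a ^ l =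
        α a * (ζq ^ (if a = 1 ∨ a = -1 then 1 else 0) - algebraMap (𝓞 K) (𝓞 Ω) ((gal p K a • u₀) ^ d)) := by
      rw [map_pow, ← hα a, ← pow_mul, ← hd, mul_sub, ← pow_succ', Nat.sub_add_cancel hl1.le]
      ring
    rw [e] at h1
    exact (‹Q.IsPrime›.mem_or_mem h1).resolve_left hα0
  refine ⟨l, hlF, 𝔩, h𝔩m, h𝔩l, hpl, hpl1, ⟨d, hd⟩, hrel, ?_, ?_⟩
  · -- `u₀` is not a `q`-th power modulo `𝔩`
    rintro ⟨z, hz⟩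
    have hz0 : z ∉ 𝔩 := fun hz0 => by
      have : u₀ ∈ 𝔩 := by
        have := Ideal.add_mem _ hz (Ideal.pow_mem_of_mem 𝔩 hz0 q hqp.pos)
        rwa [sub_add_cancel] at this
      exact hu0 1 (by rwa [gal_one, one_smul])
    -- `u₀^d ≡ z^{qd} = z^{l-1} ≡ 1 (mod 𝔩)`
    haveI : Finite (𝓞 K ⧸ 𝔩) := Nat.finite_of_card_ne_zero (by rw [hcard]; exact hl.ne_zero)
    letI : Fintype (𝓞 K ⧸ 𝔩) := Fintype.ofFinite _
    letI : Field (𝓞 K ⧸ 𝔩) := Ideal.Quotient.field _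
    have hz1 : z ^ (l - 1) - 1 ∈ 𝔩 := by
      rw [← Ideal.Quotient.eq, map_pow, map_one, ← hcard, ← Fintype.card_eq_nat_card]
      exact FiniteField.pow_card_sub_one_eq_one _ (by rwa [Ne, Ideal.Quotient.eq_zero_iff_mem])
    have hu1 : u₀ ^ d - 1 ∈ 𝔩 := by
      obtain ⟨c, hc⟩ := sub_dvd_pow_sub_pow u₀ (z ^ q) d
      have e : u₀ ^ d - 1 = (u₀ ^ d - (z ^ q) ^ d) + (z ^ (l - 1) - 1) := by
        rw [← pow_mul, hd]; ring
      rw [e, hc]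
      exact Ideal.add_mem _ (Ideal.mul_mem_right _ _ hz) hz1
    -- so `ζ_q ≡ 1 (mod Q)`, contradicting `q ∉ Q`
    have h1 := heuler 1
    rw [if_pos (Or.inl rfl), pow_one, gal_one, one_smul] at h1
    have h2 : ζq - 1 ∈ Q := by
      have e : ζq - 1 = (ζq - algebraMap (𝓞 K) (𝓞 Ω) (u₀ ^ d)) + algebraMap (𝓞 K) (𝓞 Ω) (u₀ ^ d - 1) := by
        rw [map_sub, map_one]; ring
      rw [e]
      exact Ideal.add_mem _ h1 (hmemQ.mpr hu1)
    have hζq' : IsPrimitiveRoot ζq q :=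
      IsPrimitiveRoot.coe_submonoidClass_iff.mp hζq
    exact hqQ (natCast_mem_of_sub_one_mem hζq' hqp.one_lt h2)
  · -- `u₀` is a `q`-th power modulo `σ_b 𝔩`, `b ≠ ±1`
    intro b hb1 hb2
    have ha : ¬ (b⁻¹ = 1 ∨ b⁻¹ = -1) := by
      rintro (h | h)
      · exact hb1 (inv_eq_one.mp h)
      · exact hb2 (by rw [← inv_inv b, h, inv_neg, inv_one])
    have h1 := heuler b⁻¹
    rw [if_neg ha, pow_zero] at h1
    have h2 : (gal p K b⁻¹ • u₀) ^ ((l - 1) / q) - 1 ∈ 𝔩 := by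
      rw [hd, Nat.mul_div_cancel_left _ hqp.pos, ← hmemQ, map_sub, map_one]
      rw [← neg_mem_iff, neg_sub]
      exact h1
    obtain ⟨z, hz0, hz⟩ := exists_pow_eq_of_pow_div_eq_one hcard hl1 hqp.pos ⟨d, hd⟩ (hσu0 b⁻¹) h2
    refine ⟨gal p K b • z, fun h => hz0 ?_, ?_⟩
    · exact (Ideal.smul_mem_pointwise_smul_iff (a := gal p K b)).mp h
    · have := (Ideal.smul_mem_pointwise_smul_iff (a := gal p K b)).mpr hz
      rwa [smul_sub, smul_smul, ← gal_mul, mul_inv_cancel, gal_one, one_smul, smul_pow'] at this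

end Catalan.Thaine

end Literature.NumberTheory.DiophantineGeometry
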